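/-
Copyright (c) 2026 the pub-hodgecm-mathlib formalisation cell (harness21).  Prover seat hodgecm-mathlib-LH4-p01 (g10): road M6 → F3 «TOT-Λ BY OVER-ORDERS» (LEAD F0P3a-plan
T14-66), carve (c5-ii) «MODEL PACKAGE SELECTION» (F3-5 pen LH7-p04 (g12)), FILE C «THE θ-PACKAGE OF THE UNIFORMISER ROW»; 2026-09-03.
-/
import Literature.NumberTheory.Rogawski1990.TypeTwoEigenFieldPackageUniformiser   -- ★ F4-a′ p852817 (LH4-p01 (g9)): brings ★ [T2-L] `RamifiedQuadraticDictionary` (L1) `exists_sqrt_and_coord_of_ramified`, (L2) `exists_involutions_of_ramified`, (L3) `exists_mul_map_eq_of_ramified` and the valued-field algebra used in its (nK) step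
import Literature.NumberTheory.Rogawski1990.TypeTwoUnitIndexAtPlace                 -- ★ (D5): the inert-place dictionary (★ Σ2-CM `exists_isUnit_galAdicCompletionMap_sub`, ★ `exists_toPlace_eq_of_galAdicCompletionMap_eq`, ★ `valued_toPlace_of_isUnramifiedIn`, ★ `galAdicCompletionMap_galAdicCompletionMap_of_smul_eq`), the `Valued ∕ ValuativeRel` bridge
import Literature.NumberTheory.Automorphic.TypeTwoCommutantBridge                 -- ★ (D3) §1 `valuation_map_eq_of_involutive`
import HarnessLib

/-!
# The θ-package of the uniformiser row at an inert place: `θ = √d`, `s̃ ⊃ σ_w` fixing `θ`, coordinates, integrality, isometry, and the (nK) norm clause — eigen-data-free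
# (Serre, Corps locaux I §6, II §5, V §2; Neukirch II (8.2)–(8.3))

Topic `NumberTheory/Rogawski1990`; namespace `Literature.NumberTheory.Rogawski1990`.  TWO THEOREMS (no definition, no instance, no notation, no named fact, no `sorry`); kernel
lane `--supports stmt-HodgeConjecture-24833`.  Cell `pub/hodgecm-mathlib` (D-0151), crux H413 = `stmt-HodgeConjecture-24833`; road M6 → F3 «TOT-Λ by over-orders» (route (B));
carve **(c5-ii) «MODEL PACKAGE SELECTION», FILE C**: the INPUT package of FILE A `InertPlaceIntegralEisensteinFrame.exists_integralEisensteinFrame_inertPlace` for the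
UNIFORMISER ROW (the tame row and the wild odd-discriminant row: `K = M_{w₁} = E_w(√d)`, `d` a `σ_w`-fixed uniformiser), produced EIGEN-DATA-FREE from ★ [T2-L]
`RamifiedQuadraticDictionary` (L1)(L2)(L3) — i.e. the frame half of ★ F4-a′ `exists_eigenField_package_uniformiser` (whose statement carries the eigen-data `u t D y e₂` and the deep
binders `ht2 hχ1 hn hN`), exported on its own so that F3-5b-III (any `(g, u)`, deep or not) instantiates FILE A by two calls.  The wild unit-discriminant row (`θ = (α − 1)∕ϖ^k`)
is the twin over ★ (D5)′ `TypeTwoUnitIndexAtPlaceWild`'s suppliers (not in this file).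
HONEST LABEL: HC_CM is proved only modulo the 7 printed citations (2 remaining named inputs: hLiu418 = stmt-HodgeConjecture-24832, h413 = stmt-HodgeConjecture-24833) until rung 0
closes; unconditional local algebra at a place, count-neutral (pays no organ, opens no road; zero label movement until F5 ★ + a desk-priced rider).

THE MATHEMATICS.  At the inert place `w ∣ v` (`c • w = w`, `v` unramified) the involution `σ_w` MOVES some unit `ξ` by a unit (`hmove`; ★ Σ2-CM: the residual Frobenius is not
the identity), and a `σ_w`-fixed uniformiser `d` of `E_w` is `ι_w d₀` for a uniformiser `d₀` of `F_v` (`ι_w` is an isometry onto the fixed field).  For an auxiliary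
`M = E(√m)` with `d⁻¹m` a square in `E_w`: `M_{w₁} = E_w(θ)`, `θ² = ι₁ d`, `|θ| = exp(−1)`, with unique Eisenstein coordinates and the integrality criterion (★ (L1)); `σ_w`
extends to an involution `s̃` of `M_{w₁}` fixing `θ`, integral (★ (L2)), hence isometric (★ `valuation_map_eq_of_involutive`); every `s̃`-fixed unit is a norm `t·s̃t` (★ (L3)
from `hmove`), hence every `s̃`-fixed `c ≠ 0` of EVEN order (reduce by `θ^{2k}`, `s̃θ = θ`) satisfies `a·s̃a·c = 1` — the (nK) clause.  No `|2| = 1`, no parity binder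
(T14-66 KILL clause honoured).  [cite: SerreLocalFields1979, Ch. I §6 Prop. 17–18; Ch. II §5; Ch. V §2 Prop. 3 and Cor.] [cite: Neukirch1999, Ch. II (8.2)–(8.3), §4 Prop. (4.3)]

* §1 `exists_isUnit_moved_by_galAdicCompletionMap` (`hmove` at an inert place, generic `c`);
* §2 **`exists_thetaPackage_uniformiserRow`** — `∃ d₀ θ s̃` with FILE A's twelve input letters (`hθ` in FILE A's shape with `aF := 0`, `k₀ := d₀`).

## References
* [SerreLocalFields1979] J.-P. Serre, *Local Fields*, GTM 67 (1979): Ch. I §6 Prop. 17–18; Ch. II §5; Ch. V §2 Prop. 3 and Corollary.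
* [Neukirch1999] J. Neukirch, *Algebraic Number Theory*, Grundlehren 322 (1999): Ch. II (8.2)–(8.3), §4 Prop. (4.3).
* [Rogawski1990] J. D. Rogawski, *Automorphic Representations of Unitary Groups in Three Variables*, Ann. of Math. Stud. 123 (1990): §4.9 Lemma 4.9.3 p. 56.
-/

set_option autoImplicit false

noncomputable section

open ValuativeRel NumberField IsDedekindDomain
open scoped ValuativeRel
open Literature.NumberTheory.Automorphic Literature.NumberTheory.Automorphic.UnitaryGroup Literature.NumberTheory.NumberFields

namespace Literature.NumberTheory.Rogawski1990

/-! ## §1 `hmove` at an inert place -/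

/-- **`hmove` AT AN INERT PLACE** (generic `c`): `σ_w` moves some UNIT `a` of `𝒪[E_w]` by a unit — `σ_w a − a ∈ 𝒪^×` (★ Σ2-CM `exists_isUnit_galAdicCompletionMap_sub`; `a` itself is
a unit since `σ_w` preserves `𝔪`), in the `hmove` binder shape of ★ (D2-β) ∕ ★ F4-a′ ∕ ★ [T2-L] (L3). [cite: SerreLocalFields1979, Ch. V §2 Prop. 3] -/
theorem exists_isUnit_moved_by_galAdicCompletionMap
    {F E : Type} [Field F] [NumberField F] [Field E] [NumberField E] [Algebra F E] [Algebra.IsQuadraticExtension F E]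
    (c : E ≃ₐ[F] E) (v : HeightOneSpectrum (𝓞 F)) (hc : c ≠ 1) (hunr : Algebra.IsUnramifiedIn (𝓞 E) v.asIdeal)
    (w : PlacesOver E v) (hw : c • w.1 = w.1) :
    ∃ a : 𝒪[w.1.adicCompletion E], IsUnit a ∧ galAdicCompletionMap (L := E) c hw a - a ∈ 𝒪[w.1.adicCompletion E] ∧
      ∃ b : 𝒪[w.1.adicCompletion E], (b : w.1.adicCompletion E) * (galAdicCompletionMap (L := E) c hw a - a) = 1 := by
  obtain ⟨a, hU⟩ := exists_isUnit_galAdicCompletionMap_sub c v hc hunr w hw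
  obtain ⟨U, hU'⟩ := hU
  have hσv : ∀ x : w.1.adicCompletion E, Valued.v (galAdicCompletionMap (L := E) c hw x) = Valued.v x :=
    fun x => valued_galAdicCompletionMap (L := E) c hw x
  have hunitE : ∀ x : 𝒪[w.1.adicCompletion E], IsUnit x ↔ Valued.v (x : w.1.adicCompletion E) = 1 := fun x => by
    rw [(Valuation.integer.integers (valuation (w.1.adicCompletion E))).isUnit_iff_valuation_eq_one, v_eq_one_iff_valuation_eq_one]; rfl
  have hcoeU : ((U : 𝒪[w.1.adicCompletion E]) : w.1.adicCompletion E) = galAdicCompletionMap (L := E) c hw a - a := by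
    rw [hU']; rfl
  refine ⟨a, ?_, ?_, ⟨↑U⁻¹, ?_⟩⟩
  · -- `a` is a unit: otherwise `|a| < 1`, `|σa| < 1`, so `|σa − a| < 1`, contradicting `σa − a ∈ 𝒪^×`
    by_contra ha
    have ha1 : Valued.v (a : w.1.adicCompletion E) < 1 := lt_of_le_of_ne ((v_le_one_iff_mem_integer _).2 a.2) (fun h => ha ((hunitE a).2 h))
    have hlt : Valued.v (galAdicCompletionMap (L := E) c hw a - a) < 1 :=
      lt_of_le_of_lt (Valuation.map_sub _ _ _) (max_lt (by rw [hσv]; exact ha1) ha1)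
    have hU1 : Valued.v ((U : 𝒪[w.1.adicCompletion E]) : w.1.adicCompletion E) = 1 := (hunitE _).1 U.isUnit
    rw [hcoeU] at hU1
    exact hlt.ne hU1
  · rw [← hcoeU]; exact (U : 𝒪[w.1.adicCompletion E]).2
  · rw [← hcoeU, ← Subring.coe_mul, Units.inv_mul, Subring.coe_one]

/-! ## §2 The θ-package of the uniformiser row -/

set_option maxHeartbeats 4000000 in
/-- **(c5-ii-C) THE θ-PACKAGE OF THE UNIFORMISER ROW AT AN INERT PLACE.**  `E ∕ F` quadratic number fields, `c ≠ 1`, `v` unramified, `w ∣ v` with `c • w = w`; an auxiliary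
quadratic `M ⊃ E` (`σ_M δ = −δ`, `m = δ²`) and a `σ_w`-FIXED UNIFORMISER `d` of `E_w` with `d⁻¹m` a square in `E_w` (so `M_{w₁} = E_w(√d)` is the ramified eigen-field of the
UNIFORMISER row); `w₁ ∣ w`.  THEN there are `d₀ ∈ F_v` (`ι_w d₀ = d`, `|d₀| = exp(−1)`), `θ ∈ M_{w₁}` and `s̃ : M_{w₁} →+* M_{w₁}` with ALL the input letters of FILE A
`exists_integralEisensteinFrame_inertPlace` at the Eisenstein pair `(aF, k₀) := (0, d₀)`: `θ² = ι₁ι(0)·θ + ι₁ι(d₀)`, `|θ| = exp(−1)`, unique coordinates, integrality criterion,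
`s̃ ∘ ι₁ = ι₁ ∘ σ_w`, `s̃θ = θ`, `s̃s̃ = id`, `s̃𝒪 ⊆ 𝒪`, isometry, and the (nK) clause «`s̃`-fixed of even order ⇒ `a·s̃a·c = 1`».  Eigen-data-free twin of the frame half of
★ F4-a′. [cite: SerreLocalFields1979, Ch. I §6 Prop. 17–18; Ch. II §5; Ch. V §2 Prop. 3 and Cor.] [cite: Neukirch1999, Ch. II (8.2)–(8.3), §4 Prop. (4.3)] -/
theorem exists_thetaPackage_uniformiserRow
    {F E : Type} [Field F] [NumberField F] [Field E] [NumberField E] [Algebra F E] [Algebra.IsQuadraticExtension F E]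
    (c : E ≃ₐ[F] E) (v : HeightOneSpectrum (𝓞 F)) (hc : c ≠ 1) (hunr : Algebra.IsUnramifiedIn (𝓞 E) v.asIdeal)
    (w : PlacesOver E v) (hw : c • w.1 = w.1)
    {M : Type} [Field M] [NumberField M] [Algebra E M] [Algebra.IsQuadraticExtension E M] (σM : M ≃ₐ[E] M) {δ : M} (hσδ : σM δ = -δ) (hδ : δ ≠ 0)
    {m : E} (hm : algebraMap E M m = δ ^ 2) {d : w.1.adicCompletion E} (hd : Valued.v d = WithZero.exp (-1 : ℤ))
    (hdm : IsSquare (d⁻¹ * (m : w.1.adicCompletion E))) (hσd : galAdicCompletionMap (L := E) c hw d = d) (w₁ : PlacesOver M w.1) :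
    ∃ (d₀ : v.adicCompletion F) (θ : w₁.1.adicCompletion M) (s' : w₁.1.adicCompletion M →+* w₁.1.adicCompletion M),
      toPlace v w d₀ = d ∧ Valued.v d₀ = WithZero.exp (-1 : ℤ) ∧ Valued.v (0 : v.adicCompletion F) < 1 ∧
      θ ^ 2 = toPlace w.1 w₁ (toPlace v w 0) * θ + toPlace w.1 w₁ (toPlace v w d₀) ∧ Valued.v θ = WithZero.exp (-1 : ℤ) ∧
      (∀ z : w₁.1.adicCompletion M, ∃! pq : w.1.adicCompletion E × w.1.adicCompletion E, z = toPlace w.1 w₁ pq.1 + toPlace w.1 w₁ pq.2 * θ) ∧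
      (∀ p q : w.1.adicCompletion E, toPlace w.1 w₁ p + toPlace w.1 w₁ q * θ ∈ 𝒪[w₁.1.adicCompletion M] ↔ p ∈ 𝒪[w.1.adicCompletion E] ∧ q ∈ 𝒪[w.1.adicCompletion E]) ∧
      (∀ x, s' (toPlace w.1 w₁ x) = toPlace w.1 w₁ (galAdicCompletionMap (L := E) c hw x)) ∧ s' θ = θ ∧ (∀ z, s' (s' z) = z) ∧
      (∀ z : 𝒪[w₁.1.adicCompletion M], s' z ∈ 𝒪[w₁.1.adicCompletion M]) ∧ (∀ z, Valued.v (s' z) = Valued.v z) ∧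
      (∀ c₁ : w₁.1.adicCompletion M, c₁ ≠ 0 → s' c₁ = c₁ → Even (WithZero.log (Valued.v c₁)) → ∃ a : w₁.1.adicCompletion M, a * s' a * c₁ = 1) := by
  set s := galAdicCompletionMap (L := E) c hw with hsdef
  have hσv : ∀ x : w.1.adicCompletion E, Valued.v (s x) = Valued.v x := fun x => valued_galAdicCompletionMap (L := E) c hw x
  have hss : ∀ x, s (s x) = x := galAdicCompletionMap_galAdicCompletionMap_of_smul_eq c w hc hw
  have hsO : ∀ x : 𝒪[w.1.adicCompletion E], s x ∈ 𝒪[w.1.adicCompletion E] := fun x => mem_integer_galAdicCompletionMap c v w hw x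
  have hιv : ∀ y : v.adicCompletion F, Valued.v (toPlace v w y) = Valued.v y :=
    fun y => Literature.NumberTheory.Automorphic.Liu2021.LemD1IndexedNonVacuityInertCofinite.valued_toPlace_of_isUnramifiedIn E v hunr w y
  -- `d = ι_w d₀`, `d₀` a uniformiser of `F_v`
  obtain ⟨d₀, hd₀⟩ := exists_toPlace_eq_of_galAdicCompletionMap_eq c w hc hw d hσd
  have hd₀v : Valued.v d₀ = WithZero.exp (-1 : ℤ) := by rw [← hιv, hd₀, hd]
  -- ★ (L1), (L2)
  obtain ⟨θ, hθ, hθv, hcoord, hint⟩ := exists_sqrt_and_coord_of_ramified M w.1 σM hσδ hδ hm hd hdm w₁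
  obtain ⟨⟨s', hs'ι, hs'θ, hs's', hs'O⟩, -⟩ := exists_involutions_of_ramified M w.1 σM hσδ hδ hm hd hdm w₁ s hss hσd hsO hθ
  -- isometry of `s̃` (★ (D3) §1) in both currencies
  have hs'val : ∀ z, valuation (w₁.1.adicCompletion M) (s' z) = valuation (w₁.1.adicCompletion M) z :=
    Literature.NumberTheory.Automorphic.valuation_map_eq_of_involutive s' hs's' hs'O
  have hs'v : ∀ z, Valued.v (s' z) = Valued.v z := fun z => (v_eq_iff_valuation_eq _ _).2 (hs'val z)
  -- `hmove` and ★ (L3): `s̃`-fixed units are norms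
  have hmove := exists_isUnit_moved_by_galAdicCompletionMap c v hc hunr w hw
  have hnormU : ∀ u : 𝒪[w₁.1.adicCompletion M], IsUnit u → s' u = u → ∃ t : 𝒪[w₁.1.adicCompletion M], (t : w₁.1.adicCompletion M) * s' t = u :=
    fun u hu hsu => exists_mul_map_eq_of_ramified M w.1 w₁ s hmove s' hs'ι hs's' hs'O u hu hsu
  -- (nK): reduce an `s̃`-fixed `c₁ ≠ 0` of even order by `θ^{2k}` (★ F4-a′'s step, eigen-data-free)
  have hθ0 : θ ≠ 0 := fun h0 => by rw [h0, map_zero] at hθv; exact WithZero.coe_ne_zero hθv.symm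
  have hnorm1 : ∀ c₁ : w₁.1.adicCompletion M, c₁ ≠ 0 → s' c₁ = c₁ → Even (WithZero.log (Valued.v c₁)) →
      ∃ a : w₁.1.adicCompletion M, a * s' a * c₁ = 1 := by
    intro c₁ hc0 hsc ⟨k, hk⟩
    have hvc0 : Valued.v c₁ ≠ 0 := (Valuation.ne_zero_iff _).2 hc0
    -- `u₀ := c₁ · θ^{2k}` is an `s̃`-fixed unit
    have hu₀v : Valued.v (c₁ * θ ^ (k + k)) = 1 := by
      rw [map_mul, map_zpow₀, hθv, ← WithZero.exp_zsmul, ← WithZero.exp_log hvc0, hk, ← WithZero.exp_add, ← WithZero.exp_zero]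
      congr 1; simp only [smul_eq_mul]; ring
    have hu₀O : c₁ * θ ^ (k + k) ∈ 𝒪[w₁.1.adicCompletion M] := (mem_integer_iff_valued_le_one _).2 hu₀v.le
    have hu₀ne : c₁ * θ ^ (k + k) ≠ 0 := mul_ne_zero hc0 (zpow_ne_zero _ hθ0)
    have hu₀u : IsUnit (⟨c₁ * θ ^ (k + k), hu₀O⟩ : 𝒪[w₁.1.adicCompletion M]) := by
      have hinvO : (c₁ * θ ^ (k + k))⁻¹ ∈ 𝒪[w₁.1.adicCompletion M] := (mem_integer_iff_valued_le_one _).2 (by rw [map_inv₀, hu₀v, inv_one])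
      exact IsUnit.of_mul_eq_one ⟨_, hinvO⟩ (Subtype.ext (mul_inv_cancel₀ hu₀ne))
    have hsu₀ : s' ((⟨c₁ * θ ^ (k + k), hu₀O⟩ : 𝒪[w₁.1.adicCompletion M]) : w₁.1.adicCompletion M) = c₁ * θ ^ (k + k) := by
      change s' (c₁ * θ ^ (k + k)) = _
      rw [map_mul, map_zpow₀, hsc, hs'θ]
    obtain ⟨t₀, ht₀⟩ := hnormU _ hu₀u hsu₀
    have ht₀' : (t₀ : w₁.1.adicCompletion M) * s' t₀ = c₁ * θ ^ (k + k) := ht₀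
    have ht₀0 : (t₀ : w₁.1.adicCompletion M) ≠ 0 := by
      intro h0
      rw [h0, zero_mul] at ht₀'
      exact hu₀ne ht₀'.symm
    have hs't₀0 : s' (t₀ : w₁.1.adicCompletion M) ≠ 0 := (map_ne_zero s').2 ht₀0
    refine ⟨θ ^ k * (t₀ : w₁.1.adicCompletion M)⁻¹, ?_⟩
    rw [map_mul, map_zpow₀, hs'θ, map_inv₀]
    have hθk : θ ^ k ≠ 0 := zpow_ne_zero _ hθ0
    calc θ ^ k * (t₀ : w₁.1.adicCompletion M)⁻¹ * (θ ^ k * (s' (t₀ : w₁.1.adicCompletion M))⁻¹) * c₁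
        = (c₁ * θ ^ (k + k)) * ((t₀ : w₁.1.adicCompletion M) * s' t₀)⁻¹ := by rw [zpow_add₀ hθ0, mul_inv]; ring
      _ = 1 := by rw [← ht₀', mul_inv_cancel₀ (mul_ne_zero ht₀0 hs't₀0)]
  refine ⟨d₀, θ, s', hd₀, hd₀v, by rw [map_zero]; exact zero_lt_one, ?_, hθv, hcoord, hint, hs'ι, hs'θ, hs's', hs'O, hs'v, hnorm1⟩
  rw [map_zero, map_zero, zero_mul, zero_add, hd₀]; exact hθ

end Literature.NumberTheory.Rogawski1990

end
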